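import Summits.AnomalousDissipation.AnomalousDissipation.Cruxes.GalerkinFloor.Lines.birth
import Summits.AnomalousDissipation.AnomalousDissipation.Theses.MomentParity
import Literature.Analysis.FluidPDE.GalerkinFlow
import Literature.Analysis.FluidPDE.GalerkinInvariantMeasure
import Literature.Analysis.FluidPDE.NSGalerkinStationary
import Literature.Analysis.FluidPDE.NSGalerkinTrajectory
import Literature.Analysis.FluidPDE.NSHopfGalerkinExistence
import Literature.Analysis.FluidPDE.LongTimeAveragePeriodic
import Literature.Analysis.FluidPDE.LongTimeAverageSubadditive
import Literature.Dynamics.Ergodic.AuxiliaryFunctionDualityProofs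
import Literature.Dynamics.Ergodic.KrylovBogolyubovSemiflow

/-!
# STUB-PLAN (stub critic) — typed companion for `stub_uniformGalerkinAnomaly`
# (crux `DecimationAxis.GalerkinFloor`, stmt-AnomalousDissipation-1582; skeleton `Lines/birth.lean`)

Elaboration-only file: every `theorem` below is a helper statement of the merged, ranked plan
`STUB-PLAN-stub_uniformGalerkinAnomaly.md` (same directory), stated over the birth skeleton's transparent
vocabulary (`IsDesignerForce`, `IsCoeffTrajectory`, `coeffEnergy`, `coeffDissipation`,
`Statement.stub_uniformGalerkinAnomaly`, imported from `Cruxes/GalerkinFloor/Lines/birth.lean`) and left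
`sorry` — except T1 and T8, which the critic proved as calibration (the dictionary and the truncation ceiling
are right as typed).  Nothing here is registered; the plan says which statements to register as Tools stubs.
`lean check`: rc 0, 34 sorries = 34 open helper statements, 0 errors.
Sources of the statements: the three ideation sketches `StubIdeas1Sketch.lean` (k1),
`STUB_IDEAS_stub_uniformGalerkinAnomaly_2.lean` (k2), `STUB_IDEAS_stub_uniformGalerkinAnomaly_3.lean` (k3),
merged, de-duplicated and — where the critic changed a statement — marked RETYPED.

Layers: §T balance toolkit (first Tools file) · §N negatives / design rules · §W work currency ·
§S selection lemma + segment and extremal-measure currencies · §U import up (Heart ⟹ 14283) ·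
§D import down / corners · §O optional currencies (cone, transfer deficit).
-/

noncomputable section

set_option linter.dupNamespace false
set_option linter.unusedVariables false

open Filter Set MeasureTheory Metric
open scoped Topology NNReal
open Literature.Analysis.FunctionSpaces Literature.Analysis.FunctionSpaces.Torus Literature.Analysis.FluidPDE

namespace Summit.AnomalousDissipation.AnomalousDissipation.Cruxes.GalerkinFloor.StubPlan

open Summit.AnomalousDissipation.AnomalousDissipation.Theses
open Summit.AnomalousDissipation.AnomalousDissipation.Theses.DecimationAxis
open Summit.AnomalousDissipation.AnomalousDissipation.Cruxes.GalerkinFloor.Birth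

/-- Lattice frequencies `ℤ³` (local notation). -/
local notation "ℤ³" => Fin 3 → ℤ
/-- Fourier coefficient values `ℂ³` (local notation). -/
local notation "ℂ³" => EuclideanSpace ℂ (Fin 3)

/-! ## Vocabulary added by the plan (two transparent defs; everything else is birth's §0) -/

/-- Injected power ("work") `W(t) = Σ_{k∈S} Re⟪g_k, c_k(t)⟫ = ∫⟪G, u(t)⟫` — orientation as in the tree's
`galerkin_energy_identity` (`(inner ℂ (g k) (c k)).re`). -/
def coeffWork {S : Finset ℤ³} (g : ℤ³ → ℂ³) (c : ℝ → ↥S → ℂ³) : ℝ → ℝ :=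
  fun t => ∑ k : ↥S, (inner ℂ (g k) (c t k)).re

/-- `ℓ²` size of the force on `S`: `G_S = √(Σ_{k∈S} ‖g_k‖²)`. -/
def forceSize (S : Finset ℤ³) (g : ℤ³ → ℂ³) : ℝ :=
  Real.sqrt (∑ k ∈ S, ‖g k‖ ^ 2)

/-- The registered stub, BY NAME (birth's handle): the "Heart". -/
abbrev Heart : Prop := Statement.stub_uniformGalerkinAnomaly

/-! ## §T — BALANCE TOOLKIT (first Tools file; all provable now, S–M each) -/

/-- **T1 (XS) dictionary — PROVED here (critic's calibration).** The skeleton's trajectory notion IS the tree's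
`IsGalerkinODESolution` from `c 0`. -/
theorem isCoeffTrajectory_iff {S : Finset ℤ³} {ν : ℝ} {g : ℤ³ → ℂ³} {c : ℝ → ↥S → ℂ³} :
    IsCoeffTrajectory S ν g c ↔ IsGalerkinODESolution ν (fun k : ↥S => g k) (c 0) c := by
  constructor
  · rintro ⟨h1, h2, h3⟩
    exact ⟨rfl, h1, h2, h3⟩
  · intro h
    exact ⟨h.mem, h.continuousOn, h.hasDerivWithinAt⟩

/-- **T2 (S) energy identity, differential form.** `d/dt Σ‖c_k‖² = 2(W − D)` within `[0, T]`
(`hasDerivWithinAt_energy` + `toReal_eGradNormSq_coeffExt` + `integral_inner_realTrigPoly_realTrigPoly`,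
`isRealCoeff_restrict`). -/
theorem hasDerivWithinAt_coeffEnergy {S : Finset ℤ³} (hS : ∀ k ∈ S, -k ∈ S) {ν : ℝ} {g : ℤ³ → ℂ³}
    (hg : IsConjSymm g) {c : ℝ → ↥S → ℂ³} (hc : IsCoeffTrajectory S ν g c) (T : ℝ) {t : ℝ}
    (ht : t ∈ Set.Icc (0 : ℝ) T) :
    HasDerivWithinAt (coeffEnergy c) (2 * (coeffWork g c t - coeffDissipation ν c t)) (Set.Icc 0 T) t := by
  sorry

/-- **T3 (S–M) energy identity, integrated.** `En(T) − En(0) = 2∫₀ᵀ (W − D)` (FTC on `Icc 0 T`; the pattern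
is the tree's `galerkin_energy_identity`). -/
theorem coeffEnergy_sub_eq_integral {S : Finset ℤ³} (hS : ∀ k ∈ S, -k ∈ S) {ν : ℝ} {g : ℤ³ → ℂ³}
    (hg : IsConjSymm g) {c : ℝ → ↥S → ℂ³} (hc : IsCoeffTrajectory S ν g c) {T : ℝ} (hT : 0 ≤ T) :
    coeffEnergy c T - coeffEnergy c 0 =
      2 * ∫ t in (0 : ℝ)..T, (coeffWork g c t - coeffDissipation ν c t) := by
  sorry

/-- **T3′ (S) the same in `timeMean` form.** `⟨D⟩_T = ⟨W⟩_T + (En(0) − En(T))/(2T)`. -/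
theorem timeMean_coeffDissipation_eq {S : Finset ℤ³} (hS : ∀ k ∈ S, -k ∈ S) {ν : ℝ} {g : ℤ³ → ℂ³}
    (hg : IsConjSymm g) {c : ℝ → ↥S → ℂ³} (hc : IsCoeffTrajectory S ν g c) {T : ℝ} (hT : 0 < T) :
    timeMean (coeffDissipation ν c) T =
      timeMean (coeffWork g c) T + (coeffEnergy c 0 - coeffEnergy c T) / (2 * T) := by
  sorry

/-- **T4 (S–M) absorbing ball (no mean mode).** On `S ∌ 0` every trajectory obeys
`En(t) ≤ max (En 0) (G_S²/(4π²ν)²)` for `t ≥ 0` (`freqNormSq ≥ 1` on `S`, `W ≤ G_S √En`; pattern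
`energy_le_of_isGalerkinODESolution`, Theorems/MomentParity…StubKrylovBogoliubovA). -/
theorem coeffEnergy_le_max {S : Finset ℤ³} (hS : ∀ k ∈ S, -k ∈ S) (h0 : (0 : ℤ³) ∉ S) {ν : ℝ}
    (hν : 0 < ν) {g : ℤ³ → ℂ³} (hg : IsConjSymm g) {c : ℝ → ↥S → ℂ³} (hc : IsCoeffTrajectory S ν g c)
    {t : ℝ} (ht : 0 ≤ t) :
    coeffEnergy c t ≤ max (coeffEnergy c 0) ((∑ k ∈ S, ‖g k‖ ^ 2) / (4 * Real.pi ^ 2 * ν) ^ 2) := by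
  sorry

/-- **T4′ (S) forward-invariant energy balls.** Balls `En ≤ ρ²` with `ρ ≥ G_S/(4π²ν)` are forward invariant. -/
theorem coeffEnergy_le_of_initial_le {S : Finset ℤ³} (hS : ∀ k ∈ S, -k ∈ S) (h0 : (0 : ℤ³) ∉ S)
    {ν : ℝ} (hν : 0 < ν) {g : ℤ³ → ℂ³} (hg : IsConjSymm g) {c : ℝ → ↥S → ℂ³}
    (hc : IsCoeffTrajectory S ν g c) {ρ : ℝ} (hρ : forceSize S g / (4 * Real.pi ^ 2 * ν) ≤ ρ)
    (h0c : coeffEnergy c 0 ≤ ρ ^ 2) : ∀ t, 0 ≤ t → coeffEnergy c t ≤ ρ ^ 2 := by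
  sorry

/-- **T5 (S–M) long-time balance.** `⟨D⟩⁻ = ⟨W⟩⁻` and `⟨D⟩⁺ = ⟨W⟩⁺` (T3′ + T4: the boundary term is `O(1/T)`). -/
theorem longTimeAvg_coeffDissipation_eq_coeffWork {S : Finset ℤ³} (hS : ∀ k ∈ S, -k ∈ S)
    (h0 : (0 : ℤ³) ∉ S) {ν : ℝ} (hν : 0 < ν) {g : ℤ³ → ℂ³} (hg : IsConjSymm g) {c : ℝ → ↥S → ℂ³}
    (hc : IsCoeffTrajectory S ν g c) :
    longTimeAvgInf (coeffDissipation ν c) = longTimeAvgInf (coeffWork g c) ∧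
      longTimeAvgSup (coeffDissipation ν c) = longTimeAvgSup (coeffWork g c) := by
  sorry

/-- **T6 (S) finite-time energy row.** `⟨W⟩_T ≤ G_S · √⟨En⟩_T` (Cauchy–Schwarz in `k` =
`integral_inner_realTrigPoly_coeffExt_le`, Jensen in `t` = `timeMean_sqrt_le_sqrt_timeMean`). -/
theorem timeMean_coeffWork_le {S : Finset ℤ³} {g : ℤ³ → ℂ³} {c : ℝ → ↥S → ℂ³}
    (hc : ContinuousOn c (Set.Ici 0)) {T : ℝ} (hT : 0 < T) :
    timeMean (coeffWork g c) T ≤ forceSize S g * Real.sqrt (timeMean (coeffEnergy c) T) := by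
  sorry

/-- **T6′ (S) long-time energy row.** `⟨W⟩⁺ ≤ G_S · √⟨En⟩⁺` (T6 + `Monotone.map_limsup_of_continuousAt`
for `√·`; the means are bounded by T4). -/
theorem longTimeAvgSup_coeffWork_le {S : Finset ℤ³} (hS : ∀ k ∈ S, -k ∈ S) (h0 : (0 : ℤ³) ∉ S)
    {ν : ℝ} (hν : 0 < ν) {g : ℤ³ → ℂ³} (hg : IsConjSymm g) {c : ℝ → ↥S → ℂ³}
    (hc : IsCoeffTrajectory S ν g c) :
    longTimeAvgSup (coeffWork g c) ≤ forceSize S g * Real.sqrt (longTimeAvgSup (coeffEnergy c)) := by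
  sorry

/-- **T7 (S) cone ⇒ window.** A `liminf`-mean floor `δ` for the ONE observable `Φ_λ = D − λ·En` gives both
clauses of the stub with energy budget `G_S²/λ²` (T5 + T6′; law-side twin landed: `energy_le_of_cone`). -/
theorem window_of_cone {S : Finset ℤ³} (hS : ∀ k ∈ S, -k ∈ S) (h0 : (0 : ℤ³) ∉ S) {ν : ℝ} (hν : 0 < ν)
    {g : ℤ³ → ℂ³} (hg : IsConjSymm g) {c : ℝ → ↥S → ℂ³} (hc : IsCoeffTrajectory S ν g c)
    {lam δ : ℝ} (hlam : 0 < lam) (hδ : 0 < δ)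
    (hcone : δ ≤ longTimeAvgInf (fun t => coeffDissipation ν c t - lam * coeffEnergy c t)) :
    longTimeAvgSup (coeffEnergy c) ≤ (∑ k ∈ S, ‖g k‖ ^ 2) / lam ^ 2 ∧
      δ ≤ longTimeAvgInf (coeffDissipation ν c) := by
  sorry

/-- **T8 (XS) truncation ceiling — PROVED here (critic's calibration).** On `S ⊆ freqBall K`:
`D ≤ ν·4π²K²·En` pointwise. -/
theorem coeffDissipation_le_of_subset_freqBall {S : Finset ℤ³} {K : ℕ} (hSK : S ⊆ freqBall K) {ν : ℝ}
    (hν : 0 ≤ ν) (c : ℝ → ↥S → ℂ³) (t : ℝ) :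
    coeffDissipation ν c t ≤ ν * (4 * Real.pi ^ 2 * (K : ℝ) ^ 2) * coeffEnergy c t := by
  unfold coeffDissipation coeffEnergy
  have hk : ∀ k : ↥S, freqNormSq (k : ℤ³) ≤ (K : ℝ) ^ 2 := fun k => mem_freqBall.1 (hSK k.2)
  have hsum : ∑ k : ↥S, freqNormSq (k : ℤ³) * ‖c t k‖ ^ 2 ≤ ∑ k : ↥S, (K : ℝ) ^ 2 * ‖c t k‖ ^ 2 := by
    apply Finset.sum_le_sum
    intro k _
    exact mul_le_mul_of_nonneg_right (hk k) (by positivity)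
  calc ν * (4 * Real.pi ^ 2 * ∑ k : ↥S, freqNormSq (k : ℤ³) * ‖c t k‖ ^ 2)
      ≤ ν * (4 * Real.pi ^ 2 * ∑ k : ↥S, (K : ℝ) ^ 2 * ‖c t k‖ ^ 2) := by
        gcongr
    _ = ν * (4 * Real.pi ^ 2 * (K : ℝ) ^ 2) * ∑ k : ↥S, ‖c t k‖ ^ 2 := by
        rw [← Finset.mul_sum]; ring

/-- **T9 (S) energy-row necessity.** Any witness at one level has `ε ≤ G_S · √E`: budgets are not free. -/
theorem eps_le_of_witness {S : Finset ℤ³} (hS : ∀ k ∈ S, -k ∈ S) (h0 : (0 : ℤ³) ∉ S) {ν : ℝ}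
    (hν : 0 < ν) {g : ℤ³ → ℂ³} (hg : IsConjSymm g) {c : ℝ → ↥S → ℂ³} (hc : IsCoeffTrajectory S ν g c)
    {E ε : ℝ} (hE : longTimeAvgSup (coeffEnergy c) ≤ E) (hε : ε ≤ longTimeAvgInf (coeffDissipation ν c)) :
    ε ≤ forceSize S g * Real.sqrt E := by
  sorry

/-- **T10 (S) steady witness reader.** A zero of the Galerkin field in the phase space is a constant trajectory
whose long-time means are its energy and dissipation. -/
theorem steady_isCoeffTrajectory {S : Finset ℤ³} {ν : ℝ} {g : ℤ³ → ℂ³} {a : ↥S → ℂ³}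
    (ha : a ∈ galerkinSubspace S) (h0 : galerkinRHS S ν (fun k : ↥S => g k) a = 0) :
    IsCoeffTrajectory S ν g (fun _ => a) ∧
      longTimeAvgSup (coeffEnergy (fun _ : ℝ => a)) = ∑ k : ↥S, ‖a k‖ ^ 2 ∧
      longTimeAvgInf (coeffDissipation ν (fun _ : ℝ => a)) =
        ν * (4 * Real.pi ^ 2 * ∑ k : ↥S, freqNormSq (k : ℤ³) * ‖a k‖ ^ 2) := by
  sorry

/-- **T11 (XS, in tree) periodic witness reader.** Period averages (`longTimeAvgSup/Inf_eq_of_periodic`). -/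
theorem periodic_longTimeAvg {S : Finset ℤ³} {ν : ℝ} {c : ℝ → ↥S → ℂ³} (hc : Continuous c) {τ : ℝ}
    (hτ : 0 < τ) (hper : Function.Periodic c τ) :
    longTimeAvgSup (coeffEnergy c) = τ⁻¹ * ∫ t in (0 : ℝ)..τ, coeffEnergy c t ∧
      longTimeAvgInf (coeffDissipation ν c) = τ⁻¹ * ∫ t in (0 : ℝ)..τ, coeffDissipation ν c t := by
  sorry

/-- **Tools stub to REGISTER** (`ledger workitem stub-add stmt-AnomalousDissipation-1582 --name stub_heartBalanceTools
--signature @sig.txt`, the signature being this statement's type, which deliberately uses ONLY birth §0 vocabulary +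
Literature names — `coeffWork` is inlined — so that it elaborates in the skeleton's context) and to close the first Tools
file with `⟨…, …, …, …⟩` (playbook D2; the named lemmas with `coeffWork` close it by `δ`-unfolding, as checked here).
Conjunction of T1, T3′, T4, T5. -/
theorem stub_heartBalanceTools :
    (∀ (S : Finset ℤ³) (ν : ℝ) (g : ℤ³ → ℂ³) (c : ℝ → ↥S → ℂ³),
      IsCoeffTrajectory S ν g c ↔ IsGalerkinODESolution ν (fun k : ↥S => g k) (c 0) c) ∧
    (∀ (S : Finset ℤ³), (∀ k ∈ S, -k ∈ S) → ∀ (ν : ℝ) (g : ℤ³ → ℂ³), IsConjSymm g →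
      ∀ c : ℝ → ↥S → ℂ³, IsCoeffTrajectory S ν g c → ∀ T : ℝ, 0 < T →
        timeMean (coeffDissipation ν c) T =
          timeMean (fun t => ∑ k : ↥S, (inner ℂ (g k) (c t k)).re) T +
            (coeffEnergy c 0 - coeffEnergy c T) / (2 * T)) ∧
    (∀ (S : Finset ℤ³), (∀ k ∈ S, -k ∈ S) → (0 : ℤ³) ∉ S → ∀ ν : ℝ, 0 < ν → ∀ g : ℤ³ → ℂ³, IsConjSymm g →
      ∀ c : ℝ → ↥S → ℂ³, IsCoeffTrajectory S ν g c → ∀ t : ℝ, 0 ≤ t →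
        coeffEnergy c t ≤ max (coeffEnergy c 0) ((∑ k ∈ S, ‖g k‖ ^ 2) / (4 * Real.pi ^ 2 * ν) ^ 2)) ∧
    (∀ (S : Finset ℤ³), (∀ k ∈ S, -k ∈ S) → (0 : ℤ³) ∉ S → ∀ ν : ℝ, 0 < ν → ∀ g : ℤ³ → ℂ³, IsConjSymm g →
      ∀ c : ℝ → ↥S → ℂ³, IsCoeffTrajectory S ν g c →
        longTimeAvgInf (coeffDissipation ν c) =
            longTimeAvgInf (fun t => ∑ k : ↥S, (inner ℂ (g k) (c t k)).re) ∧
          longTimeAvgSup (coeffDissipation ν c) =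
            longTimeAvgSup (fun t => ∑ k : ↥S, (inner ℂ (g k) (c t k)).re)) :=
  ⟨fun S ν g c => isCoeffTrajectory_iff,
    fun S hS ν g hg c hc T hT => timeMean_coeffDissipation_eq hS hg hc hT,
    fun S hS h0 ν hν g hg c hc t ht => coeffEnergy_le_max hS h0 hν hg hc ht,
    fun S hS h0 ν hν g hg c hc => longTimeAvg_coeffDissipation_eq_coeffWork hS h0 hν hg hc⟩

/-! ## §N — NEGATIVES / DESIGN RULES (cheap; the first entries of a future `Disproof.lean`) -/

/-- **N1 (S) the `K₀`-uniform strengthening is FALSE.** One truncation threshold for every `j` forces, at `K = K₀`,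
`⟨D⟩⁻ ≤ 4π²K₀²ν_j·E → 0 < ε` (T8 + T4): `∀ j ∃ K₀` is load-bearing and `K₀(j)² ≥ ε/(4π²ν_jE)`. -/
theorem not_heart_with_uniform_threshold :
    ¬ ∃ (N : ℕ) (g : ℤ³ → ℂ³), IsDesignerForce N g ∧ ∃ (E ε : ℝ), 0 < ε ∧ ∃ ν : ℕ → ℝ,
      (∀ j, 0 < ν j) ∧ Tendsto ν atTop (nhds 0) ∧
      ∃ K₀ : ℕ, ∀ j, ∀ K, K₀ ≤ K → ∀ S : Finset ℤ³, S = (freqBall K).erase 0 →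
        ∃ c : ℝ → ↥S → ℂ³, IsCoeffTrajectory S (ν j) g c ∧
          longTimeAvgSup (coeffEnergy c) ≤ E ∧ ε ≤ longTimeAvgInf (coeffDissipation (ν j) c) := by
  sorry

/-- **N2 (S) necessary shape of ANY witness at one level `(ν, K)`** (T9 + T8 for designer forces on the
punctured ball — RETYPED by the critic: stated as a constraint on the witness's own budgets, not as an `∃`):
`ε ≤ ‖g‖_{ℓ²(freqBall N)}·√E` (energy row) and `ε ≤ 4π²K²·ν·E` (truncation ceiling ⇒ `K₀(j)² ≥ ε/(4π²ν_jE)`). -/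
theorem heart_budget_necessary {N : ℕ} {g : ℤ³ → ℂ³} (hg : IsDesignerForce N g) {ν : ℝ} (hν : 0 < ν)
    {K : ℕ} {S : Finset ℤ³} (hS : S = (freqBall K).erase 0) {c : ℝ → ↥S → ℂ³}
    (hc : IsCoeffTrajectory S ν g c) {E ε : ℝ} (hE : longTimeAvgSup (coeffEnergy c) ≤ E)
    (hε : ε ≤ longTimeAvgInf (coeffDissipation ν c)) :
    ε ≤ Real.sqrt (∑ k ∈ freqBall N, ‖g k‖ ^ 2) * Real.sqrt E ∧
      ε ≤ 4 * Real.pi ^ 2 * (K : ℝ) ^ 2 * ν * E := by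
  sorry

/-! ## §W — WORK CURRENCY (k1 Plan A; XS once T5 is in) -/

/-- **Injection persistence**: the stub with the floor on the `liminf`-mean INJECTED POWER instead of the total
dissipation (the form used by the route header's two-layer plan and by the dyadic proof, arXiv:0810.3718 Thm 4.2). -/
def InjectionPersistence : Prop :=
  ∃ (N : ℕ) (g : ℤ³ → ℂ³), IsDesignerForce N g ∧ ∃ (E ε : ℝ), 0 < ε ∧ ∃ ν : ℕ → ℝ,
    (∀ j, 0 < ν j) ∧ Tendsto ν atTop (nhds 0) ∧
    ∀ j, ∃ K₀ : ℕ, ∀ K, K₀ ≤ K → ∀ S : Finset ℤ³, S = (freqBall K).erase 0 →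
      ∃ c : ℝ → ↥S → ℂ³, IsCoeffTrajectory S (ν j) g c ∧
        longTimeAvgSup (coeffEnergy c) ≤ E ∧ ε ≤ longTimeAvgInf (coeffWork g c)

/-- **W1 (XS after T5).** Heart ⟺ injection persistence (termwise). -/
theorem heart_iff_injectionPersistence : Heart ↔ InjectionPersistence := by
  sorry

/-! ## §S — THE SELECTION LEMMA and the two finite currencies (k2 Plan 1 ∩ k3 Plan A; the shared load-bearing
provable helper) -/

/-- **SEL (M) window selection for the Galerkin coefficient semiflow — RETYPED (robust, with pigeonhole).**
On a compact forward-invariant `B ⊆ galerkinSubspace S`: if for every horizon `T` SOME orbit segment in `B`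
has `∫₀ᵀ f ≥ −C₀`, then for every `η > 0` ONE orbit in `B` has ALL running integrals of `f + η` bounded below
(hence `liminf`-mean of `f` ≥ `−η`).  Proof route: transport the tree's PROVED
`Literature.Dynamics.Ergodic.exists_orbit_integral_bounded_below` (deficit `0`, `∀ T > 0`) along a continuous
linear equivalence `(↥S → ℂ³) ≃L[ℝ] EuclideanSpace ℝ (Fin m)` (`toEuclidean`), after the pigeonhole reduction
"`∫₀^{nT}(f+η) ≥ ηnT − C₀ ≥ 0` ⇒ one of the `n` windows of length `T` is `≥ 0`, and it is an orbit segment by the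
semigroup law `galerkinCoeffFlow_add`".  Fallback: re-prove the 120-line compactness argument in place. -/
theorem exists_orbit_runningIntegral_bounded_below {S : Finset ℤ³} (hS : ∀ k ∈ S, -k ∈ S) {ν : ℝ}
    (hν : 0 ≤ ν) {g : ↥S → ℂ³} (hg : IsRealCoeff g) {B : Set (↥S → ℂ³)} (hB : IsCompact B)
    (hne : B.Nonempty) (hBV : B ⊆ (galerkinSubspace S : Set (↥S → ℂ³)))
    (hinv : ∀ t, 0 ≤ t → Set.MapsTo (galerkinCoeffFlow ν g t) B B)
    {f : (↥S → ℂ³) → ℝ} (hf : ContinuousOn f B) {C₀ : ℝ}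
    (hseg : ∀ T, 0 ≤ T → ∃ b ∈ B, -C₀ ≤ ∫ t in (0 : ℝ)..T, f (galerkinCoeffFlow ν g t b))
    {η : ℝ} (hη : 0 < η) :
    ∃ b ∈ B, ∃ C : ℝ, ∀ T, 0 ≤ T → -C ≤ ∫ t in (0 : ℝ)..T, (f (galerkinCoeffFlow ν g t b) + η) := by
  sorry

/-- **SEL₀ (M) the deficit-free form** (exactly the tree lemma's shape, transported): no `η` loss. -/
theorem exists_orbit_runningIntegral_bounded_below₀ {S : Finset ℤ³} (hS : ∀ k ∈ S, -k ∈ S) {ν : ℝ}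
    (hν : 0 ≤ ν) {g : ↥S → ℂ³} (hg : IsRealCoeff g) {B : Set (↥S → ℂ³)} (hB : IsCompact B)
    (hne : B.Nonempty) (hBV : B ⊆ (galerkinSubspace S : Set (↥S → ℂ³)))
    (hinv : ∀ t, 0 ≤ t → Set.MapsTo (galerkinCoeffFlow ν g t) B B)
    {f : (↥S → ℂ³) → ℝ} (hf : ContinuousOn f B)
    (hpos : ∀ T, 0 < T → ∃ b ∈ B, 0 ≤ ∫ t in (0 : ℝ)..T, f (galerkinCoeffFlow ν g t b)) :
    ∃ b ∈ B, ∃ C : ℝ, ∀ T, 0 ≤ T → -C ≤ ∫ t in (0 : ℝ)..T, f (galerkinCoeffFlow ν g t b) := by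
  sorry

/-- **S-LAW (S–M after SEL₀) law ⇒ orbit — RETYPED by the critic on the invariant ENERGY ball.**  An invariant
Borel probability law of the level-`S` semiflow carried by `galerkinSubspace S ∩ closedBall 0 R` (sup-norm ball
of the Pi type — NOT forward invariant itself) with `∫Φ dμ ≥ δ` has an orbit, started in the forward-invariant
compact energy ball `{Σ‖c_k‖² ≤ ρ²}`, `ρ² = max (|S|·R²) (G_S²/(4π²ν)²)` (T4′; it contains the carrier), whose
`liminf` time-mean of `Φ` is `≥ δ`.  Proof: Fubini + invariance give, for every `T`, `∫ (∫₀ᵀ (Φ∘φ_t − δ) dt) dμ ≥ 0`,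
hence some `b` in the carrier with `∫₀ᵀ (Φ − δ)(φ_t b) ≥ 0` (a continuous function negative on a set of full
measure has negative integral); then SEL₀ on the energy ball.  (k3's A7 — arbitrary compact carrier `K`,
conclusion `c₀ ∈ K` — is not provable as typed: `K` need not be forward invariant.) -/
theorem exists_orbit_of_invariantLaw {S : Finset ℤ³} (hS : ∀ k ∈ S, -k ∈ S) (h0 : (0 : ℤ³) ∉ S)
    {ν : ℝ} (hν : 0 < ν) {g : ℤ³ → ℂ³} (hg : IsConjSymm g) {R : ℝ}
    {μ : Measure (↥S → ℂ³)} [IsProbabilityMeasure μ]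
    (hμB : μ ((galerkinSubspace S : Set (↥S → ℂ³)) ∩ closedBall 0 R)ᶜ = 0)
    (hinv : ∀ t, 0 ≤ t → μ.map (galerkinCoeffFlow ν (fun k : ↥S => g k) t) = μ)
    {Φ : (↥S → ℂ³) → ℝ} (hΦ : Continuous Φ) {δ : ℝ} (hδ : δ ≤ ∫ x, Φ x ∂μ) :
    ∃ c₀ ∈ (galerkinSubspace S : Set (↥S → ℂ³)),
      (∑ k : ↥S, ‖c₀ k‖ ^ 2 ≤
          max (S.card * R ^ 2) ((∑ k ∈ S, ‖g k‖ ^ 2) / (4 * Real.pi ^ 2 * ν) ^ 2)) ∧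
      δ ≤ longTimeAvgInf (fun t => Φ (galerkinCoeffFlow ν (fun k : ↥S => g k) t c₀)) := by
  sorry

/-- **S-KB (M) orbit ⇒ law (Krylov–Bogoliubov along a realising subsequence).**  Every trajectory hands its
`liminf` time-mean of a continuous `Φ` to SOME invariant law carried by the absorbing ball
(`exists_invariantMeasure_tendsto_timeAverage_semiflow` on the compact forward-invariant ball, as a subtype). -/
theorem exists_invariantLaw_of_orbit {S : Finset ℤ³} (hS : ∀ k ∈ S, -k ∈ S) (h0 : (0 : ℤ³) ∉ S)
    {ν : ℝ} (hν : 0 < ν) {g : ℤ³ → ℂ³} (hg : IsConjSymm g) {c : ℝ → ↥S → ℂ³}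
    (hc : IsCoeffTrajectory S ν g c) {Φ : (↥S → ℂ³) → ℝ} (hΦ : Continuous Φ) :
    ∃ μ : Measure (↥S → ℂ³), IsProbabilityMeasure μ ∧
      (∀ t, 0 ≤ t → μ.map (galerkinCoeffFlow ν (fun k : ↥S => g k) t) = μ) ∧
      μ ((galerkinSubspace S : Set (↥S → ℂ³)) ∩ closedBall 0
        (max (Real.sqrt (coeffEnergy c 0)) (forceSize S g / (4 * Real.pi ^ 2 * ν))))ᶜ = 0 ∧
      longTimeAvgInf (fun t => Φ (c t)) ≤ ∫ x, Φ x ∂μ := by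
  sorry

/-- **EXTREMAL-MEASURE CURRENCY (k3 Plan A)**: the Heart's open core per `(j, K)` as ONE number — some invariant
law on the absorbing ball with `∫(D − λ·En) dμ ≥ δ`, eventually in `K`. -/
def ExtremalLoud : Prop :=
  ∃ (N : ℕ) (g : ℤ³ → ℂ³), IsDesignerForce N g ∧ ∃ (lam δ : ℝ), 0 < lam ∧ 0 < δ ∧ ∃ ν : ℕ → ℝ,
    (∀ j, 0 < ν j) ∧ Tendsto ν atTop (nhds 0) ∧
    ∀ j, ∃ K₀ : ℕ, ∀ K, K₀ ≤ K → ∀ S : Finset ℤ³, S = (freqBall K).erase 0 →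
      ∃ (R : ℝ) (μ : Measure (↥S → ℂ³)), IsProbabilityMeasure μ ∧
        μ ((galerkinSubspace S : Set (↥S → ℂ³)) ∩ closedBall 0 R)ᶜ = 0 ∧
        (∀ t, 0 ≤ t → μ.map (galerkinCoeffFlow (ν j) (fun k : ↥S => g k) t) = μ) ∧
        δ ≤ ∫ x, (ν j * (4 * Real.pi ^ 2 * ∑ k : ↥S, freqNormSq (k : ℤ³) * ‖x k‖ ^ 2) -
          lam * ∑ k : ↥S, ‖x k‖ ^ 2) ∂μ

/-- **S2 (S after S-LAW + T7 + T1; converse S after S-KB).** Heart ⟺ ExtremalLoud (`λ := ε/(2E)`, `δ := ε/2`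
forward; `E := ‖g‖²/λ²`, `ε := δ` backward, enlarging `R` to the absorbing radius). -/
theorem heart_iff_extremalLoud : Heart ↔ ExtremalLoud := by
  sorry

/-- **SEGMENT CURRENCY (k2 Plan 1)**: finite-horizon penalised-work segments, every instance `(j, K, T)` a
property of ONE polynomial ODE on a compact ball. -/
def LoudSegments : Prop :=
  ∃ (N : ℕ) (g : ℤ³ → ℂ³), IsDesignerForce N g ∧ ∃ (lam m C₀ : ℝ), 0 < lam ∧ 0 < m ∧ ∃ ν : ℕ → ℝ,
    (∀ j, 0 < ν j) ∧ Tendsto ν atTop (nhds 0) ∧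
    ∀ j, ∃ K₀ : ℕ, ∀ K, K₀ ≤ K → ∀ S : Finset ℤ³, S = (freqBall K).erase 0 →
      ∃ ρ : ℝ, forceSize S g / (4 * Real.pi ^ 2 * ν j) ≤ ρ ∧
        ∀ T : ℝ, 0 ≤ T → ∃ c : ℝ → ↥S → ℂ³, IsCoeffTrajectory S (ν j) g c ∧ coeffEnergy c 0 ≤ ρ ^ 2 ∧
          -C₀ ≤ ∫ t in (0 : ℝ)..T, (coeffWork g c t - lam * coeffEnergy c t - m)

/-- **S3 (M) conversion** (k2 H3): bounded orbit + running penalised work bounded below ⇒ the stub's two clauses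
with explicit budgets `E = (G/lam)²`, `ε = m` (T3 + T6 + `x ≤ a√x + o(1) ⇒ limsup x ≤ a²`). -/
theorem heartClauses_of_runningIntegral {S : Finset ℤ³} (hS : ∀ k ∈ S, -k ∈ S) (h0 : (0 : ℤ³) ∉ S)
    {ν : ℝ} (hν : 0 < ν) {g : ℤ³ → ℂ³} (hg : IsConjSymm g) {c : ℝ → ↥S → ℂ³}
    (hc : IsCoeffTrajectory S ν g c) {ρ : ℝ} (hbd : ∀ t, 0 ≤ t → coeffEnergy c t ≤ ρ ^ 2)
    {G lam m C : ℝ} (hG : forceSize S g ≤ G) (hlam : 0 < lam) (hm : 0 < m)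
    (hrun : ∀ T, 0 ≤ T → -C ≤ ∫ t in (0 : ℝ)..T, (coeffWork g c t - lam * coeffEnergy c t - m)) :
    longTimeAvgSup (coeffEnergy c) ≤ (G / lam) ^ 2 ∧ m ≤ longTimeAvgInf (coeffDissipation ν c) := by
  sorry

/-- **S4 (S after SEL + S3; converse S–M by pigeonhole).** Heart ⟺ LoudSegments — a certified currency change
(`heart_of`: `E := (G/lam)²`, `ε := m/2` through SEL with `η := m/2`; `of_heart`: `lam := ε/(4(E+1))`,
`m := ε/4`, `C₀ := 0`, windows `[iT, (i+1)T]` of a heart trajectory, shifted by autonomy). -/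
theorem heart_iff_loudSegments : Heart ↔ LoudSegments := by
  sorry

/-! ## §U — IMPORT UP: Heart ⟹ one-trajectory Taylor ⟹ `MomentParity.GalerkinInvariantLoud` (stmt-14283)
(k1 Plan B; NOT self-contained: uses the landed S1–S3 of 14283's line `taylor`) -/

/-- The force FIELD of a designer force: `G = realTrigPoly (freqBall N) g`. -/
def forceField (N : ℕ) (g : ℤ³ → ℂ³) : UnitAddTorus (Fin 3) → EuclideanSpace ℝ (Fin 3) :=
  realTrigPoly (freqBall N) g

/-- **U0 (S) force dictionary.** Smooth, divergence free, mean zero, Fourier coefficients `g`; `g ≠ 0 ⇒ G ≠ 0`. -/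
theorem forceField_spec {N : ℕ} {g : ℤ³ → ℂ³} (hg : IsDesignerForce N g) :
    IsSmooth (forceField N g) ∧ IsDivFree (forceField N g) ∧ HasZeroMean (forceField N g) ∧
      (∀ k : ℤ³, UnitAddTorus.mFourierCoeff
        (Literature.Analysis.FunctionSpaces.EuclideanSpace.complexify ∘ forceField N g) k = g k) ∧
      (g ≠ 0 → forceField N g ≠ 0) := by
  sorry

/-- **U1 (M) zero-mode EXTENSION.** Padding a stub trajectory on the punctured ball by a zero mean mode gives the
tree's full-ball Galerkin ODE solution (the padded mode has zero right-hand side: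
`galerkinRHS_apply_eq_zero_of_coe_eq_zero`, `convectionCoeff_zero_freq_of_isTransversal`, WazewskiBlock's landed
`stub_meanZeroInvariant`). -/
theorem isGalerkinODESolution_pad_of_isCoeffTrajectory {K : ℕ} {ν : ℝ} {N : ℕ} {g : ℤ³ → ℂ³}
    (hg : IsDesignerForce N g) {c : ℝ → ↥((freqBall K).erase 0) → ℂ³}
    (hc : IsCoeffTrajectory ((freqBall K).erase 0) ν g c) :
    IsGalerkinODESolution ν (fun k : ↥(freqBall K) => g k)
      (fun k : ↥(freqBall K) => coeffExt ((freqBall K).erase 0) (c 0) k.1)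
      (fun t (k : ↥(freqBall K)) => coeffExt ((freqBall K).erase 0) (c t) k.1) := by
  sorry

/-- **U2 (M) field dictionary.** For `K ≥ N` a stub trajectory is the field-level Galerkin orbit
`Torus.galerkinFlow ν G K · a` of the mean-zero level-`K` mode `a = realTrigPoly S (c 0)`, with the stub's two
functionals equal to `‖u‖₂²` and `ν‖∇u‖₂²` of the slices (U1 + uniqueness `IsGalerkinODESolution.eqOn` +
`IsGalerkinMode.galerkinFlow_eq`; `kineticEnergy_realTrigPoly`, `toReal_eGradNormSq_realTrigPoly`; pattern
`orbit_dictionary`, Theorems/MomentParityMomentLadderRealTime). -/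
theorem galerkinFlow_eq_of_isCoeffTrajectory {N K : ℕ} (hNK : N ≤ K) {S : Finset ℤ³}
    (hS : S = (freqBall K).erase 0) {ν : ℝ} (hν : 0 < ν) {g : ℤ³ → ℂ³} (hg : IsDesignerForce N g)
    {c : ℝ → ↥S → ℂ³} (hc : IsCoeffTrajectory S ν g c) :
    IsGalerkinMode K (realTrigPoly S (coeffExt S (c 0))) ∧ HasZeroMean (realTrigPoly S (coeffExt S (c 0))) ∧
      ∀ t, 0 ≤ t →
        Torus.galerkinFlow ν (forceField N g) K t (realTrigPoly S (coeffExt S (c 0))) =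
            realTrigPoly S (coeffExt S (c t)) ∧
          (∫ x, ‖realTrigPoly S (coeffExt S (c t)) x‖ ^ 2) = coeffEnergy c t ∧
          ν * (eGradNormSq (realTrigPoly S (coeffExt S (c t)))).toReal = coeffDissipation ν c t := by
  sorry

/-- **U3 (S) window ⇒ cone, real time — RETYPED by the critic** (the real-`T` sibling of the landed
`le_liminf_ratio`, which assumes convergent integer means): for continuous `D, En ≥ 0` on `[0, ∞)` with
`D ≤ M·En` pointwise (here T8: `M = 4π²K²ν`), `liminf`-mean `D ≥ ε > 0` and `limsup`-mean `En ≤ E`, the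
cumulative ratio has `liminf_T ∫₀ᵀD/∫₀ᵀEn ≥ ε/E`.  The domination hypothesis is LOAD-BEARING: without it
`D ≡ 1, En ≡ 0, ε = E = 1` satisfies every other hypothesis while the ratio is the junk value `x/0 = 0`. -/
theorem le_liminf_integral_ratio {D En : ℝ → ℝ} (hD : ContinuousOn D (Set.Ici 0))
    (hEn : ContinuousOn En (Set.Ici 0)) (hD0 : ∀ t, 0 ≤ D t) (hEn0 : ∀ t, 0 ≤ En t)
    {M : ℝ} (hDEn : ∀ t, 0 ≤ t → D t ≤ M * En t) {ε E : ℝ}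
    (hε : 0 < ε) (hE : 0 < E) (hDε : ε ≤ longTimeAvgInf D) (hEnE : longTimeAvgSup En ≤ E)
    (hbd : ∃ C, ∀ T, 0 ≤ T → timeMean En T ≤ C) :
    ε / E ≤ Filter.liminf (fun T : ℝ => (∫ t in (0 : ℝ)..T, D t) / ∫ t in (0 : ℝ)..T, En t) atTop := by
  sorry

/-- **U4 (M) Heart ⟹ the one-trajectory Taylor statement** (`stub_oneTrajectoryTaylor` of
`Cruxes/GalerkinInvariantLoud/Lines/taylor_cone_homogenisation.lean:250`, verbatim) with `f := forceField N g`,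
`κ := ε/E` (U2 dictionary, U3, `∀ᶠ K ⇒ ∃ᶠ N`; `g ≠ 0` and `E > 0` are forced by T5/T8). -/
theorem oneTrajectoryTaylor_of_heart : Heart →
    ∃ f : UnitAddTorus (Fin 3) → EuclideanSpace ℝ (Fin 3),
      IsSmooth f ∧ IsDivFree f ∧ HasZeroMean f ∧ f ≠ 0 ∧
      ∃ (ν : ℕ → ℝ) (κ : ℝ), (∀ j, 0 < ν j) ∧ Tendsto ν atTop (nhds 0) ∧ 0 < κ ∧
        ∀ j : ℕ, ∃ᶠ N in atTop, ∃ a : UnitAddTorus (Fin 3) → EuclideanSpace ℝ (Fin 3),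
          IsGalerkinMode N a ∧ HasZeroMean a ∧
          κ ≤ Filter.liminf (fun T : ℝ =>
            (ν j * (∫⁻ t in Ioo 0 T, eGradNormSq (Torus.galerkinFlow (ν j) f N t a)).toReal) /
              (∫ t in (0 : ℝ)..T, ∫ x, ‖Torus.galerkinFlow (ν j) f N t a x‖ ^ 2)) atTop := by
  sorry

/-- **U5 (XS after U4) Heart ⟹ GalerkinInvariantLoud (stmt-14283)** — the three-line body of
`TaylorConeHomogenisation.GalerkinInvariantLoud_of` with the LANDED `stub_taylorReduction`, `stub_energyFloor`,
`stub_krylovBogoliubov`.  Contrapositives with landed arrows: `¬GIL → ¬Heart`, `¬W → ¬Heart`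
(`not_galerkinInvariantLoud_of_not_workLaw`), `¬QuarticGate → ¬Heart` (`not_galerkinInvariantLoud_of_not_quarticGate`);
and `¬Heart → ¬GalerkinFloor` (resolved ≤ total) — the decisive kill chain of the whole crux. -/
theorem galerkinInvariantLoud_of_heart : Heart → MomentParity.GalerkinInvariantLoud := by
  sorry

/-- **U6 (XS) the crux needs the Heart** (`coeffResolvedDissipation ≤ coeffDissipation`, checked in
`Lines/fraction.lean` §4): `GalerkinFloor → Heart`; so `¬Heart` refutes the crux and breaks the route. -/
theorem heart_of_galerkinFloor : GalerkinFloor → Heart := by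
  sorry

/-! ## §D — IMPORT DOWN / CORNERS (wiring: the stub closes automatically if a sibling programme lands) -/

/-- **D1 (S) steady corner.** Eventually-in-`K` loud bounded STEADY Galerkin states for a designer force (the
`∀ᶠ K`, designer-force sharpening of `MirrorVariety.GalerkinSteadyZerothLaw`, stmt-2986) give the Heart (T10). -/
theorem heart_of_steadyEventually
    (h : ∃ (N : ℕ) (g : ℤ³ → ℂ³), IsDesignerForce N g ∧ ∃ (E ε : ℝ), 0 < ε ∧ ∃ ν : ℕ → ℝ,
      (∀ j, 0 < ν j) ∧ Tendsto ν atTop (nhds 0) ∧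
      ∀ j, ∃ K₀ : ℕ, ∀ K, K₀ ≤ K → ∀ S : Finset ℤ³, S = (freqBall K).erase 0 →
        ∃ c₀ : ↥S → ℂ³, c₀ ∈ galerkinSubspace S ∧ galerkinRHS S (ν j) (fun k => g k) c₀ = 0 ∧
          ∑ k : ↥S, ‖c₀ k‖ ^ 2 ≤ E ∧
          ε ≤ ν j * (4 * Real.pi ^ 2 * ∑ k : ↥S, freqNormSq (k : ℤ³) * ‖c₀ k‖ ^ 2)) :
    Heart := by
  sorry

/-- **D2 (M) Ważewski corner, MEAN-ZERO reading of `WazewskiBlock.UniformWorkFloorTrap` (stmt-10353).**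
Pointwise window `KE ≤ E`, `(f, U) ≥ ε₀` for every `N ≥ N₀(ν)` PLUS `HasZeroMean (U 0)` ⇒ Heart
(`ν_j := ν₀/(j+1)`, `g := f̂`, `Torus.isGalerkinTrajectory_iff`/`IsGalerkinTrajectory.isGalerkinODESolution`,
zero-mode excision, pointwise ⇒ time means, T5).  As TYPED 10353 lacks the mean-zero clause (Galilean drift) —
flagged to WazewskiBlock tenure, not repaired here. -/
theorem heart_of_workFloorTrap_meanZero
    (h : ∃ (m : ℕ) (f : UnitAddTorus (Fin 3) → EuclideanSpace ℝ (Fin 3)), IsGalerkinMode m f ∧ HasZeroMean f ∧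
      ∃ (E ε₀ ν₀ : ℝ), 0 < ε₀ ∧ 0 < ν₀ ∧ ∀ ν : ℝ, 0 < ν → ν ≤ ν₀ → ∃ N₀ : ℕ, ∀ N : ℕ, N₀ ≤ N →
        ∃ U : ℝ → UnitAddTorus (Fin 3) → EuclideanSpace ℝ (Fin 3), Torus.IsGalerkinTrajectory ν f N U ∧
          HasZeroMean (U 0) ∧ ∀ t : ℝ, 0 ≤ t → kineticEnergy (U t) ≤ E ∧ ε₀ ≤ ∫ x, inner ℝ (f x) (U t x)) :
    Heart := by
  sorry

/-! ## §O — OPTIONAL CURRENCIES (lower priority; each isolates the same open core in another observable) -/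

/-- **O1 (M–L) energy floor along bounded trajectories, uniform in `K ≥ N` and `ν ≤ ν₀`** (k2 H4; trajectory
transcription of the landed law-side `stub_energyFloor`: test against `G`, average
`d/dt W = ‖g‖² − ν·4π²Σ|k|²Re⟪g_k,c_k⟫ − τ`, bound `|τ| ≤ ‖∇G‖_∞·En`; the floor is on the `liminf`-mean). -/
theorem energyFloor_trajectory {N : ℕ} {g : ℤ³ → ℂ³} (hg : IsDesignerForce N g) (hg0 : g ≠ 0) :
    ∃ e₀ ν₀ : ℝ, 0 < e₀ ∧ 0 < ν₀ ∧ ∀ ν : ℝ, 0 < ν → ν ≤ ν₀ → ∀ K : ℕ, N ≤ K → ∀ S : Finset ℤ³,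
      S = (freqBall K).erase 0 → ∀ c : ℝ → ↥S → ℂ³, IsCoeffTrajectory S ν g c →
        e₀ ≤ longTimeAvgInf (coeffEnergy c) := by
  sorry

/-- **CONE CURRENCY (k2 Plan 2 / census S1, k2's statement verbatim)**: one projective (cumulative-ratio)
inequality on one bounded trajectory, eventually in `K`, along `ν_j → 0⁺` (`E`, `ε` become OUTPUTS: the energy
budget `G²/κ²` from T3′ + T6, the floor `κ·e₀` from O1; the boundedness clause is automatic by T4). -/
def TaylorCone : Prop :=
  ∃ (N : ℕ) (g : ℤ³ → ℂ³), IsDesignerForce N g ∧ g ≠ 0 ∧ ∃ κ : ℝ, 0 < κ ∧ ∃ ν : ℕ → ℝ,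
    (∀ j, 0 < ν j) ∧ Tendsto ν atTop (nhds 0) ∧
    ∀ j, ∃ K₀ : ℕ, ∀ K, K₀ ≤ K → ∀ S : Finset ℤ³, S = (freqBall K).erase 0 →
      ∃ c : ℝ → ↥S → ℂ³, IsCoeffTrajectory S (ν j) g c ∧ (∃ ρ : ℝ, ∀ t, 0 ≤ t → coeffEnergy c t ≤ ρ ^ 2) ∧
        ∃ T₀ : ℝ, ∀ T, T₀ ≤ T →
          κ * ∫ t in (0 : ℝ)..T, coeffEnergy c t ≤ ∫ t in (0 : ℝ)..T, coeffDissipation (ν j) c t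

/-- **O2 (S after O1 + T7).** TaylorCone ⟺ Heart (re-index `j ↦ j + J` so that `ν_j ≤ ν₀`, `K₀ ≥ N`;
law-side twins landed: `stub_taylorReduction`, `taylorConverse`). -/
theorem heart_iff_taylorCone : Heart ↔ TaylorCone := by
  sorry

/-- Transfer out of the forcing modes `τ(t) = Σ_{k∈S} Re⟪g_k, 𝓕[(u·∇)u](k)⟫` (k3 §D). -/
def coeffTransfer {S : Finset ℤ³} (g : ℤ³ → ℂ³) (c : ℝ → ↥S → ℂ³) : ℝ → ℝ :=
  fun t => ∑ k : ↥S, (inner ℂ (g k) (Torus.convectionCoeff S (coeffExt S (c t)) (coeffExt S (c t)) k)).re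

/-- Single-shell force: all active modes have the same `|k|² = κ₀` (Taylor–Green `κ₀ = 3`, ABC `κ₀ = 1`). -/
def IsSingleShell (κ₀ : ℝ) (g : ℤ³ → ℂ³) : Prop :=
  ∀ k, g k ≠ 0 → freqNormSq k = κ₀

/-- **O3 (S–M) exact first-order identity (k3 D1+D2).** For a transversal single-shell `g` carried by `S`:
`⟨D⟩⁻ = (‖g‖² − ⟨τ⟩⁺)/(4π²κ₀ν)` — the stub's floor `ε` IS a transfer deficit linear in `ν`. -/
theorem longTimeAvgInf_coeffDissipation_eq_deficit {S : Finset ℤ³} (hS : ∀ k ∈ S, -k ∈ S)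
    (h0 : (0 : ℤ³) ∉ S) {ν κ₀ : ℝ} (hν : 0 < ν) (hκ₀ : 0 < κ₀) {N : ℕ} {g : ℤ³ → ℂ³}
    (hg : IsDesignerForce N g) (hshell : IsSingleShell κ₀ g) (hsupp : ∀ k, g k ≠ 0 → k ∈ S)
    {c : ℝ → ↥S → ℂ³} (hc : IsCoeffTrajectory S ν g c) :
    longTimeAvgInf (coeffDissipation ν c) =
      ((∑ k ∈ S, ‖g k‖ ^ 2) - longTimeAvgSup (coeffTransfer g c)) / (4 * Real.pi ^ 2 * κ₀ * ν) := by
  sorry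

end Summit.AnomalousDissipation.AnomalousDissipation.Cruxes.GalerkinFloor.StubPlan

end
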